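import Summits.Langlands.Langlands.Theorems.SkinnerWilesDefectOneFiveIsogenyEllipticCurvesAdaptedBasis
import Literature.NumberTheory.EllipticCurves.FramedTateGaloisRep
import HarnessLib

/-!
# The two integral frames of `V_ℓ E` adapted to a rational `ℓ`-isogeny (étale and multiplicative)
(route `SkinnerWilesDefectOne`, item stmt-Langlands-12922 `FiveIsogenyEllipticCurves`, helper)

Let `(e₀, e₁)` be a `ℤ_ℓ`-basis of `T = T_ℓ E` with `e₀` lifting the generator `P` of a
Galois-stable line of `E[ℓ]` (`…AdaptedBasis.exists_basis_proj_one_eq`), so that the Galois matrices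
in `e` are `(a b; c d)` with `ℓ ∣ c`.  The headline corollary frames `V = ℚ_ℓ ⊗ T` in

* the **étale frame** `b = (1 ⊗ e₀, 1 ⊗ e₁)` (matrices `(a b; c d)`), used when inertia above `ℓ`
  FIXES `P`, and
* the **multiplicative frame** `b̃ = (1 ⊗ e₁, ℓ⁻¹ ⊗ e₀)` (the lattice `ℓ⁻¹ ℤ_ℓ e₀ + ℤ_ℓ e₁`;
  matrices `(d c/ℓ; ℓb a)`), used when inertia above `ℓ` acts trivially on `E[ℓ]/⟨P⟩`,

so that in either case the matrices are integral with lower-left entry `≡ 0` and upper-left entry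
`≡ 1 (mod ℓ)` at inertia elements — the residual sub-character is the UNRAMIFIED one, as the
Skinner–Wiles orientation demands.  This file records the matrix entries in the two frames
(`toMatrix_etaleBasis`, `toMatrix_multBasis_*`), their integrality, and the residual congruences
(`not_dvd_sub_of_dvd`: `ℓ ∣ c`, `ℓ ∣ a - 1` (or `d - 1`), `ℓ ∤ det - 1` force `ℓ ∤ a - d`).

References: C. Skinner, A. Wiles, Publ. Math. IHÉS 89 (1999), §4.6 (the basis with
`ρ̄ = (1 ∗; 0 χ)`); J.-P. Serre (1968), I.1.1 (lattices).
-/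

noncomputable section

-- `Summit.Langlands.Langlands.…`: summit = sub-problem name (D-0017 layout), as in every Theorems file here.
set_option linter.dupNamespace false

open Literature.NumberTheory.EllipticCurves Literature.NumberTheory.EllipticCurves.TateModule
open WeierstrassCurve Field

namespace Summit.Langlands.Langlands.Theorems.FiveIsogenyEllipticCurves

/-! ### Congruences for `2 × 2` matrices over `ℤ_ℓ` -/

section Congruence

variable {ℓ : ℕ} [hℓ : Fact ℓ.Prime]

/-- **The residual diagonal is distinguished**: for `M ∈ M₂(ℤ_ℓ)` with `ℓ ∣ M₁₀`, if one diagonal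
entry is `≡ 1` and `det M ≢ 1 (mod ℓ)` then `M₀₀ ≢ M₁₁ (mod ℓ)` (the other diagonal entry is
`≡ det M`). [folklore] -/
theorem not_dvd_sub_of_dvd (M : Matrix (Fin 2) (Fin 2) ℤ_[ℓ]) (h10 : (ℓ : ℤ_[ℓ]) ∣ M 1 0)
    (hdiag : (ℓ : ℤ_[ℓ]) ∣ M 0 0 - 1 ∨ (ℓ : ℤ_[ℓ]) ∣ M 1 1 - 1) (hdet : ¬ (ℓ : ℤ_[ℓ]) ∣ M.det - 1) :
    ¬ (ℓ : ℤ_[ℓ]) ∣ M 0 0 - M 1 1 := by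
  intro hsub
  apply hdet
  rw [Matrix.det_fin_two]
  have h00 : (ℓ : ℤ_[ℓ]) ∣ M 0 0 - 1 := by
    rcases hdiag with h | h
    · exact h
    · have := dvd_add hsub h; rwa [sub_add_sub_cancel] at this
  have h11 : (ℓ : ℤ_[ℓ]) ∣ M 1 1 - 1 := by
    have := dvd_sub h00 hsub; rwa [sub_sub_sub_cancel_left] at this
  obtain ⟨x, hx⟩ := h00
  obtain ⟨y, hy⟩ := h11
  obtain ⟨z, hz⟩ := h10
  have e00 : M 0 0 = 1 + ℓ * x := by rw [← hx]; ring
  have e11 : M 1 1 = 1 + ℓ * y := by rw [← hy]; ring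
  rw [e00, e11, hz]
  exact ⟨x + y + ℓ * x * y - M 0 1 * z, by ring⟩

/-- Norms and divisibility in `ℤ_ℓ`: `‖x‖ < 1 ↔ ℓ ∣ x`, restated through `ℚ_ℓ`. [folklore] -/
theorem norm_coe_lt_one_iff_dvd (x : ℤ_[ℓ]) : ‖(x : ℚ_[ℓ])‖ < 1 ↔ (ℓ : ℤ_[ℓ]) ∣ x := by
  rw [PadicInt.padic_norm_e_of_padicInt, PadicInt.norm_lt_one_iff_dvd]

/-- An element of `ℓ ℤ_ℓ` has norm `≤ ℓ⁻¹` in `ℚ_ℓ`. [folklore] -/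
theorem norm_coe_le_inv_of_dvd {x : ℤ_[ℓ]} (h : (ℓ : ℤ_[ℓ]) ∣ x) : ‖(x : ℚ_[ℓ])‖ ≤ (ℓ : ℝ)⁻¹ := by
  obtain ⟨y, rfl⟩ := h
  rw [PadicInt.coe_mul, norm_mul, PadicInt.coe_natCast, Padic.norm_p]
  exact mul_le_of_le_one_right (inv_nonneg.mpr (Nat.cast_nonneg _))
    ((PadicInt.padic_norm_e_of_padicInt y).symm ▸ PadicInt.norm_le_one y)

end Congruence

/-! ### The étale frame -/

section Etale

variable {K : Type} [Field K] (W : WeierstrassCurve K) (ℓ : ℕ) [hℓ : Fact ℓ.Prime]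

/-- **Matrices in the étale frame** `b = (1 ⊗ e₀, 1 ⊗ e₁)`: the matrix of `V_ℓ(σ)` in `b` is the
matrix of `T_ℓ(σ)` in `e`, with entries mapped into `ℚ_ℓ`. [folklore] -/
theorem toMatrix_etaleBasis (e : Module.Basis (Fin 2) ℤ_[ℓ] (W.tateModule ℓ)) (σ : absoluteGaloisGroup K)
    (i j : Fin 2) :
    LinearMap.toMatrix (Algebra.TensorProduct.basis ℚ_[ℓ] e) (Algebra.TensorProduct.basis ℚ_[ℓ] e)
      (W.rationalGaloisRepTate ℓ σ) i j = (LinearMap.toMatrix e e (W.galoisRepTate ℓ σ) i j : ℚ_[ℓ]) := by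
  have h := LinearMap.toMatrix_baseChange ℚ_[ℓ] (W.galoisRepTate ℓ σ) e e
  exact congrFun (congrFun h i) j

/-- The étale frame is integral. [folklore] -/
theorem norm_toMatrix_etaleBasis_le_one (e : Module.Basis (Fin 2) ℤ_[ℓ] (W.tateModule ℓ))
    (σ : absoluteGaloisGroup K) (i j : Fin 2) :
    ‖LinearMap.toMatrix (Algebra.TensorProduct.basis ℚ_[ℓ] e) (Algebra.TensorProduct.basis ℚ_[ℓ] e)
      (W.rationalGaloisRepTate ℓ σ) i j‖ ≤ 1 := by
  rw [toMatrix_etaleBasis, PadicInt.padic_norm_e_of_padicInt]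
  exact PadicInt.norm_le_one _

/-- In the étale frame the lower-left entry has norm `< 1` when `σ` stabilises the line of
`P = proj₁ e₀`. [folklore] -/
theorem norm_toMatrix_etaleBasis_one_zero_lt_one (e : Module.Basis (Fin 2) ℤ_[ℓ] (W.tateModule ℓ))
    {P : geomPoints W} (he : proj ℓ 1 (e 0) = P) {σ : absoluteGaloisGroup K} {a : ℕ}
    (hσ : σ • P = a • P) :
    ‖LinearMap.toMatrix (Algebra.TensorProduct.basis ℚ_[ℓ] e) (Algebra.TensorProduct.basis ℚ_[ℓ] e)
      (W.rationalGaloisRepTate ℓ σ) 1 0‖ < 1 := by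
  rw [toMatrix_etaleBasis, PadicInt.padic_norm_e_of_padicInt, LinearMap.toMatrix_apply]
  exact (norm_repr_lt_one_of_smul_proj_eq W ℓ e he hσ).1

/-- **Residual data in the étale frame**: if `σ` FIXES `P` and `det T_ℓ(σ) ≢ 1 (mod ℓ)`, then the
upper-left entry is `≡ 1` and the diagonal entries are distinct `mod ℓ`. [folklore] -/
theorem residual_etaleBasis (e : Module.Basis (Fin 2) ℤ_[ℓ] (W.tateModule ℓ)) {P : geomPoints W}
    (he : proj ℓ 1 (e 0) = P) {σ : absoluteGaloisGroup K} (hσ : σ • P = P)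
    (hdet : ¬ (ℓ : ℤ_[ℓ]) ∣ LinearMap.det (W.galoisRepTate ℓ σ) - 1) :
    ‖LinearMap.toMatrix (Algebra.TensorProduct.basis ℚ_[ℓ] e) (Algebra.TensorProduct.basis ℚ_[ℓ] e)
        (W.rationalGaloisRepTate ℓ σ) 0 0 - 1‖ < 1 ∧
      ¬ ‖LinearMap.toMatrix (Algebra.TensorProduct.basis ℚ_[ℓ] e)
          (Algebra.TensorProduct.basis ℚ_[ℓ] e) (W.rationalGaloisRepTate ℓ σ) 0 0 -
        LinearMap.toMatrix (Algebra.TensorProduct.basis ℚ_[ℓ] e)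
          (Algebra.TensorProduct.basis ℚ_[ℓ] e) (W.rationalGaloisRepTate ℓ σ) 1 1‖ < 1 := by
  set M := LinearMap.toMatrix e e (W.galoisRepTate ℓ σ) with hM
  have h10 : (ℓ : ℤ_[ℓ]) ∣ M 1 0 := by
    rw [← PadicInt.norm_lt_one_iff_dvd, hM, LinearMap.toMatrix_apply]
    exact (norm_repr_lt_one_of_smul_proj_eq W ℓ e he (a := 1) (by rw [hσ, one_smul])).1
  have h00 : (ℓ : ℤ_[ℓ]) ∣ M 0 0 - 1 := by
    rw [← PadicInt.norm_lt_one_iff_dvd, hM, LinearMap.toMatrix_apply]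
    exact norm_repr_sub_one_lt_one_of_smul_proj_eq_self W ℓ e he hσ
  have hdet' : ¬ (ℓ : ℤ_[ℓ]) ∣ M.det - 1 := by rwa [hM, LinearMap.det_toMatrix]
  have hne := not_dvd_sub_of_dvd M h10 (Or.inl h00) hdet'
  simp only [toMatrix_etaleBasis, ← hM]
  constructor
  · rw [← PadicInt.coe_one, ← PadicInt.coe_sub, norm_coe_lt_one_iff_dvd]; exact h00
  · rw [← PadicInt.coe_sub, norm_coe_lt_one_iff_dvd]; exact hne

end Etale

/-! ### The multiplicative frame -/

section Mult

variable {K : Type} [Field K] (W : WeierstrassCurve K) (ℓ : ℕ) [hℓ : Fact ℓ.Prime]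

/-- The scaling units `(ℓ⁻¹, 1)` of the multiplicative frame. [folklore] -/
theorem isUnit_inv_natCast : IsUnit ((ℓ : ℚ_[ℓ])⁻¹) :=
  (Ne.isUnit (Nat.cast_ne_zero.mpr hℓ.out.ne_zero : (ℓ : ℚ_[ℓ]) ≠ 0)).inv

/-- **Entries in the multiplicative frame.**  For a `ℚ_ℓ`-basis `b = (b₀, b₁)` of a module and
the basis `b̃ = (b₁, ℓ⁻¹ b₀)` (`(b.unitsSMul w).reindex (swap 0 1)` with `w = (ℓ⁻¹, 1)`), the matrix
of an endomorphism `A` with matrix `N` in `b` has entries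
`Ñ₀₀ = N₁₁`, `Ñ₁₀ = ℓ N₀₁`, `Ñ₀₁ = ℓ⁻¹ N₁₀`, `Ñ₁₁ = N₀₀`. [folklore] -/
theorem toMatrix_multBasis {V : Type*} [AddCommGroup V] [Module ℚ_[ℓ] V]
    (b : Module.Basis (Fin 2) ℚ_[ℓ] V) (A : V →ₗ[ℚ_[ℓ]] V) :
    LinearMap.toMatrix ((b.unitsSMul ![(isUnit_inv_natCast ℓ).unit, 1]).reindex (Equiv.swap 0 1))
        ((b.unitsSMul ![(isUnit_inv_natCast ℓ).unit, 1]).reindex (Equiv.swap 0 1)) A 0 0 =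
      LinearMap.toMatrix b b A 1 1 ∧
    LinearMap.toMatrix ((b.unitsSMul ![(isUnit_inv_natCast ℓ).unit, 1]).reindex (Equiv.swap 0 1))
        ((b.unitsSMul ![(isUnit_inv_natCast ℓ).unit, 1]).reindex (Equiv.swap 0 1)) A 1 0 =
      (ℓ : ℚ_[ℓ]) * LinearMap.toMatrix b b A 0 1 ∧
    LinearMap.toMatrix ((b.unitsSMul ![(isUnit_inv_natCast ℓ).unit, 1]).reindex (Equiv.swap 0 1))
        ((b.unitsSMul ![(isUnit_inv_natCast ℓ).unit, 1]).reindex (Equiv.swap 0 1)) A 0 1 =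
      (ℓ : ℚ_[ℓ])⁻¹ * LinearMap.toMatrix b b A 1 0 ∧
    LinearMap.toMatrix ((b.unitsSMul ![(isUnit_inv_natCast ℓ).unit, 1]).reindex (Equiv.swap 0 1))
        ((b.unitsSMul ![(isUnit_inv_natCast ℓ).unit, 1]).reindex (Equiv.swap 0 1)) A 1 1 =
      LinearMap.toMatrix b b A 0 0 := by
  set w : Fin 2 → ℚ_[ℓ]ˣ := ![(isUnit_inv_natCast ℓ).unit, 1] with hw
  set bt := (b.unitsSMul w).reindex (Equiv.swap 0 1) with hbt
  have hw0 : ((w 0 : ℚ_[ℓ]ˣ) : ℚ_[ℓ]) = (ℓ : ℚ_[ℓ])⁻¹ := by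
    rw [hw]
    exact IsUnit.unit_spec _
  have hw0' : (((w 0)⁻¹ : ℚ_[ℓ]ˣ) : ℚ_[ℓ]) = (ℓ : ℚ_[ℓ]) := by
    rw [Units.val_inv_eq_inv_val, hw0, inv_inv]
  have hw1 : w 1 = 1 := by rw [hw]; rfl
  have hs0 : (Equiv.swap (0 : Fin 2) 1).symm 0 = 1 := rfl
  have hs1 : (Equiv.swap (0 : Fin 2) 1).symm 1 = 0 := rfl
  have hbt0 : bt 0 = b 1 := by
    rw [hbt, Module.Basis.reindex_apply, hs0, Module.Basis.unitsSMul_apply, hw1, one_smul]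
  have hbt1 : bt 1 = ((ℓ : ℚ_[ℓ])⁻¹) • b 0 := by
    rw [hbt, Module.Basis.reindex_apply, hs1, Module.Basis.unitsSMul_apply, Units.smul_def, hw0]
  have hrepr0 : ∀ x, bt.repr x 0 = b.repr x 1 := by
    intro x
    rw [hbt, Module.Basis.repr_reindex_apply, hs0, Module.Basis.repr_unitsSMul, hw1, inv_one, one_smul]
  have hrepr1 : ∀ x, bt.repr x 1 = (ℓ : ℚ_[ℓ]) * b.repr x 0 := by
    intro x
    rw [hbt, Module.Basis.repr_reindex_apply, hs1, Module.Basis.repr_unitsSMul, Units.smul_def, hw0',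
      smul_eq_mul]
  have hℓ0 : (ℓ : ℚ_[ℓ]) ≠ 0 := Nat.cast_ne_zero.mpr hℓ.out.ne_zero
  refine ⟨?_, ?_, ?_, ?_⟩
  · rw [LinearMap.toMatrix_apply, LinearMap.toMatrix_apply, hbt0, hrepr0]
  · rw [LinearMap.toMatrix_apply, LinearMap.toMatrix_apply, hbt0, hrepr1]
  · rw [LinearMap.toMatrix_apply, LinearMap.toMatrix_apply, hbt1, hrepr0]
    simp only [map_smul, Finsupp.smul_apply, smul_eq_mul]
  · rw [LinearMap.toMatrix_apply, LinearMap.toMatrix_apply, hbt1, hrepr1]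
    simp only [map_smul, Finsupp.smul_apply, smul_eq_mul]
    rw [← mul_assoc, mul_inv_cancel₀ hℓ0, one_mul]

/-- **The multiplicative frame of `V_ℓ E` is integral with small lower-left entry** when the
`ℤ_ℓ`-basis `e` of `T_ℓ E` is adapted to the stable line of `P = proj₁ e₀`: with
`b = (1 ⊗ e₀, 1 ⊗ e₁)` and `b̃ = (b₁, ℓ⁻¹ b₀)`, all entries of the matrices in `b̃` have norm `≤ 1`
and the lower-left one has norm `< 1`. [folklore] -/
theorem norm_toMatrix_multBasis (e : Module.Basis (Fin 2) ℤ_[ℓ] (W.tateModule ℓ)) {P : geomPoints W}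
    (he : proj ℓ 1 (e 0) = P) (hstab : ∀ σ : absoluteGaloisGroup K, ∃ a : ℕ, σ • P = a • P)
    (σ : absoluteGaloisGroup K) :
    (∀ i j, ‖LinearMap.toMatrix
        (((Algebra.TensorProduct.basis ℚ_[ℓ] e).unitsSMul ![(isUnit_inv_natCast ℓ).unit, 1]).reindex
          (Equiv.swap 0 1))
        (((Algebra.TensorProduct.basis ℚ_[ℓ] e).unitsSMul ![(isUnit_inv_natCast ℓ).unit, 1]).reindex
          (Equiv.swap 0 1)) (W.rationalGaloisRepTate ℓ σ) i j‖ ≤ 1) ∧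
      ‖LinearMap.toMatrix
        (((Algebra.TensorProduct.basis ℚ_[ℓ] e).unitsSMul ![(isUnit_inv_natCast ℓ).unit, 1]).reindex
          (Equiv.swap 0 1))
        (((Algebra.TensorProduct.basis ℚ_[ℓ] e).unitsSMul ![(isUnit_inv_natCast ℓ).unit, 1]).reindex
          (Equiv.swap 0 1)) (W.rationalGaloisRepTate ℓ σ) 1 0‖ < 1 := by
  set bt := ((Algebra.TensorProduct.basis ℚ_[ℓ] e).unitsSMul ![(isUnit_inv_natCast ℓ).unit, 1]).reindex
    (Equiv.swap 0 1) with hbt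
  obtain ⟨e00, e10, e01, e11⟩ := toMatrix_multBasis ℓ (Algebra.TensorProduct.basis ℚ_[ℓ] e)
    (W.rationalGaloisRepTate ℓ σ)
  rw [← hbt] at e00 e10 e01 e11
  obtain ⟨a, ha⟩ := hstab σ
  have h10 : (ℓ : ℤ_[ℓ]) ∣ LinearMap.toMatrix e e (W.galoisRepTate ℓ σ) 1 0 := by
    rw [← PadicInt.norm_lt_one_iff_dvd, LinearMap.toMatrix_apply]
    exact (norm_repr_lt_one_of_smul_proj_eq W ℓ e he ha).1
  have hℓnorm : ‖(ℓ : ℚ_[ℓ])‖ < 1 := Padic.norm_p_lt_one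
  have hℓpos : (0 : ℝ) < ℓ := Nat.cast_pos.mpr hℓ.out.pos
  have n10 : ‖LinearMap.toMatrix bt bt (W.rationalGaloisRepTate ℓ σ) 1 0‖ < 1 := by
    rw [e10, norm_mul, toMatrix_etaleBasis, PadicInt.padic_norm_e_of_padicInt]
    exact mul_lt_one_of_nonneg_of_lt_one_left (norm_nonneg _) hℓnorm (PadicInt.norm_le_one _)
  refine ⟨fun i j => ?_, n10⟩
  fin_cases i <;> fin_cases j
  · change ‖LinearMap.toMatrix bt bt _ 0 0‖ ≤ 1
    rw [e00]; exact norm_toMatrix_etaleBasis_le_one W ℓ e σ 1 1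
  · change ‖LinearMap.toMatrix bt bt _ 0 1‖ ≤ 1
    rw [e01, norm_mul, norm_inv, Padic.norm_p, inv_inv, toMatrix_etaleBasis]
    calc (ℓ : ℝ) * ‖(LinearMap.toMatrix e e (W.galoisRepTate ℓ σ) 1 0 : ℚ_[ℓ])‖
        ≤ ℓ * (ℓ : ℝ)⁻¹ := by gcongr; exact norm_coe_le_inv_of_dvd h10
      _ = 1 := mul_inv_cancel₀ hℓpos.ne'
  · change ‖LinearMap.toMatrix bt bt _ 1 0‖ ≤ 1
    exact n10.le
  · change ‖LinearMap.toMatrix bt bt _ 1 1‖ ≤ 1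
    rw [e11]; exact norm_toMatrix_etaleBasis_le_one W ℓ e σ 0 0

/-- **Residual data in the multiplicative frame**: if `σ` acts trivially on `E[ℓ]/⟨P⟩`
(`σ R - R ∈ ℕ P` for `R ∈ E[ℓ]`) and `det T_ℓ(σ) ≢ 1 (mod ℓ)`, then in `b̃` the upper-left entry
is `≡ 1` and the diagonal entries are distinct `mod ℓ`. [folklore] -/
theorem residual_multBasis (e : Module.Basis (Fin 2) ℤ_[ℓ] (W.tateModule ℓ)) {P : geomPoints W}
    (he : proj ℓ 1 (e 0) = P) {σ : absoluteGaloisGroup K} {a₀ : ℕ} (hσ0 : σ • P = a₀ • P)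
    {a₁ : ℕ} (hσ1 : σ • proj ℓ 1 (e 1) - proj ℓ 1 (e 1) = a₁ • P)
    (hdet : ¬ (ℓ : ℤ_[ℓ]) ∣ LinearMap.det (W.galoisRepTate ℓ σ) - 1) :
    ‖LinearMap.toMatrix
        (((Algebra.TensorProduct.basis ℚ_[ℓ] e).unitsSMul ![(isUnit_inv_natCast ℓ).unit, 1]).reindex
          (Equiv.swap 0 1))
        (((Algebra.TensorProduct.basis ℚ_[ℓ] e).unitsSMul ![(isUnit_inv_natCast ℓ).unit, 1]).reindex
          (Equiv.swap 0 1)) (W.rationalGaloisRepTate ℓ σ) 0 0 - 1‖ < 1 ∧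
      ¬ ‖LinearMap.toMatrix
        (((Algebra.TensorProduct.basis ℚ_[ℓ] e).unitsSMul ![(isUnit_inv_natCast ℓ).unit, 1]).reindex
          (Equiv.swap 0 1))
        (((Algebra.TensorProduct.basis ℚ_[ℓ] e).unitsSMul ![(isUnit_inv_natCast ℓ).unit, 1]).reindex
          (Equiv.swap 0 1)) (W.rationalGaloisRepTate ℓ σ) 0 0 -
        LinearMap.toMatrix
        (((Algebra.TensorProduct.basis ℚ_[ℓ] e).unitsSMul ![(isUnit_inv_natCast ℓ).unit, 1]).reindex
          (Equiv.swap 0 1))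
        (((Algebra.TensorProduct.basis ℚ_[ℓ] e).unitsSMul ![(isUnit_inv_natCast ℓ).unit, 1]).reindex
          (Equiv.swap 0 1)) (W.rationalGaloisRepTate ℓ σ) 1 1‖ < 1 := by
  set bt := ((Algebra.TensorProduct.basis ℚ_[ℓ] e).unitsSMul ![(isUnit_inv_natCast ℓ).unit, 1]).reindex
    (Equiv.swap 0 1) with hbt
  obtain ⟨e00, -, -, e11⟩ := toMatrix_multBasis ℓ (Algebra.TensorProduct.basis ℚ_[ℓ] e)
    (W.rationalGaloisRepTate ℓ σ)
  rw [← hbt] at e00 e11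
  set M := LinearMap.toMatrix e e (W.galoisRepTate ℓ σ) with hM
  have h10 : (ℓ : ℤ_[ℓ]) ∣ M 1 0 := by
    rw [← PadicInt.norm_lt_one_iff_dvd, hM, LinearMap.toMatrix_apply]
    exact (norm_repr_lt_one_of_smul_proj_eq W ℓ e he hσ0).1
  have h11 : (ℓ : ℤ_[ℓ]) ∣ M 1 1 - 1 := by
    rw [← PadicInt.norm_lt_one_iff_dvd, hM, LinearMap.toMatrix_apply]
    exact norm_repr_sub_one_lt_one_of_smul_proj_sub W ℓ e he hσ1
  have hdet' : ¬ (ℓ : ℤ_[ℓ]) ∣ M.det - 1 := by rwa [hM, LinearMap.det_toMatrix]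
  have hne := not_dvd_sub_of_dvd M h10 (Or.inr h11) hdet'
  have hne' : ¬ (ℓ : ℤ_[ℓ]) ∣ M 1 1 - M 0 0 := fun h => hne (by
    have := dvd_neg.mpr h; rwa [neg_sub] at this)
  rw [e00, e11, toMatrix_etaleBasis, toMatrix_etaleBasis, ← hM]
  constructor
  · rw [← PadicInt.coe_one, ← PadicInt.coe_sub, norm_coe_lt_one_iff_dvd]; exact h11
  · rw [← PadicInt.coe_sub, norm_coe_lt_one_iff_dvd]; exact hne'

end Mult

end Summit.Langlands.Langlands.Theorems.FiveIsogenyEllipticCurves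

end
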